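import Summits.KontsevichZagierPeriods.Zeta5Search.SymmetricPhatDescent
import Literature.NumberTheory.LFunctions.LcmUptoCubeBound
import HarnessLib

/-!
# Brown–Zudilin 2022 display (6), middle inclusion, for ALL `n`: `2·d_n²·d_{2n}·P̂_n ∈ ℤ`; Zudilin 2002 display (6):
`2D_n³p̃_n ∈ ℤ` (cell `pub-zeta5`, seat ct-1 g46)

HONEST FRAMING: systematic search; no irrationality claim unless certified.  INTEGRALITY of the rational coefficients
`P̂_n` (the `ζ(3)`-companion of the totally symmetric cellular family, Brown–Zudilin arXiv:2210.03391 Sect. 2) and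
`p̃_n = (−1)^{n+1}C(2n,n)P̂_n` (Zudilin, Mat. Zametki **72** (2002), (2), (15)); nothing here concerns the arithmetic
nature of `ζ(5)` or `ζ(3)`; no `γ` / record statement; records in print UNMOVED; net named-fact debt 0.  Theorems only.

STATUS IN PRINT of what is proved here: an OBSERVATION.  [Zudilin 2002, §1, display (6)]: "straightforward calculations
on the basis of the recursion (1) show that `q_n ∈ ℤ, 2D_n⁵p_n ∈ ℤ, 2D_n³p̃_n ∈ ℤ`" (proved there, before (6): `4D_n⁵p̃_n ∈ ℤ`);
[Brown–Zudilin 2022, Sect. 2, (6)]: `Q_n, d_n²d_{2n}P̂_n, d_n⁵P_n ∈ ℤ` "experimentally" (false as printed at `n = 1`; with the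
factor `2` the middle inclusion holds — the cell's `SymmetricFamilyCertificates.denominators` certifies `1 ≤ n ≤ 50`).
THIS FILE PROVES THE MIDDLE / THIRD INCLUSION FOR EVERY `n ≥ 1`; the `ζ(5)`-companion (`2D_n⁵p_n`, `12d_n⁵P_n`) stays OPEN.

OUR work (Summit side), assembling `SymmetricPhatDescent.two_mul_Phat_eq_neg_sum` (`2P̂_n = −Σ_{κ=n}^{2n} w_κ a_κ` with
`d_κ²d_n a_κ ∈ ℤ` — Brown–Zudilin's descent (22) on the diagonal + Rhin–Viola's Theorem 2.1 + Apéry) with ONE arithmetic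
lemma (Kummer's carry):

* **`lcmUpto_dvd_lcmUpto_mul_choose`** — for `n ≤ κ ≤ 2n`: **`d_κ ∣ d_n·C(κ,n)`** (if `p^{ℓ+1} ≤ κ` with `ℓ = ⌊log_p n⌋`, the
  base-`p` addition `n + (κ−n) = κ` carries out of the digit `ℓ`, so `p ∣ C(κ,n)`: `Nat.factorization_choose`);
* `lcmUpto_sq_dvd` — hence `d_κ² ∣ d_n·C(κ,n)·d_{2n}`;
* **`two_mul_lcm_sq_lcm_two_mul_Phat_isInt`** — `∃ z : ℤ, z = 2·d_n²·d_{2n}·P̂_n` for every `n ≥ 1` (the weights of (22) are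
  `w_κ = ±C(κ,n)C(n,κ−n)²`, so `d_n²d_{2n}w_κa_κ = ±C(n,κ−n)²·(d_nC(κ,n)d_{2n}/d_κ²)·(d_κ²d_na_κ) ∈ ℤ` termwise);
* **`two_mul_lcmUpto_pow_three_mul_ptilde_isInt`** — Zudilin's `∃ z : ℤ, z = 2·D_n³·p̃_n` for every `n ≥ 1` (the gauge
  `p̃_n = (−1)^{n+1}C(2n,n)P̂_n`, `TotallySymmetric.ptilde_eq_gauge`, and `d_{2n} ∣ d_n·C(2n,n)` = the case `κ = 2n`);
* `bz_display6_middle`, `zudilin_display6_third` — the same in the statement shape of `SymmetricFamilyCertificates.denominators` /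
  `zudilin_display6` (there: `n ≤ 50` by kernel computation; here: all `n ≥ 1`).
-/

noncomputable section

open Finset

namespace Summit.KontsevichZagierPeriods.Zeta5Search.SymmetricPhatDenominators

open Literature.NumberTheory.Irrationality
open Literature.NumberTheory.Irrationality.BrownZudilin2022 (w22 pOf qOf zchoose Phat gauge ptilde_eq_gauge)
open Summit.KontsevichZagierPeriods.Zeta5Search.SymRay (aDiag zchoose_natCast)
open Summit.KontsevichZagierPeriods.Zeta5Search.SymmetricPhatDescent (two_mul_Phat_eq_neg_sum w22_aDiag)

/-! ### Kummer's carry: `d_κ ∣ d_n·C(κ,n)` for `n ≤ κ ≤ 2n` -/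

/-- **Kummer's carry.** For `n ≤ κ ≤ 2n`: `d_κ ∣ d_n·C(κ,n)` (`d_m = lcm(1,…,m)`).  For a prime `p` with `⌊log_p κ⌋ = ⌊log_p n⌋` there
is nothing to show; otherwise `p^{ℓ+1} ≤ κ ≤ 2n` with `ℓ = ⌊log_p n⌋`, and adding `n + (κ−n)` in base `p` (both `< p^{ℓ+1}`) carries
out of the digit `ℓ`, so `p ∣ C(κ,n)`. -/
theorem lcmUpto_dvd_lcmUpto_mul_choose {n κ : ℕ} (h1 : n ≤ κ) (h2 : κ ≤ 2 * n) :
    Nat.lcmUpto κ ∣ Nat.lcmUpto n * κ.choose n := by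
  have hC : κ.choose n ≠ 0 := (Nat.choose_pos h1).ne'
  rw [← Nat.factorization_le_iff_dvd (Nat.lcmUpto_ne_zero κ) (mul_ne_zero (Nat.lcmUpto_ne_zero n) hC)]
  intro p
  rw [Nat.factorization_mul (Nat.lcmUpto_ne_zero n) hC, Finsupp.add_apply]
  by_cases hp : p.Prime
  · rw [Nat.factorization_lcmUpto κ hp, Nat.factorization_lcmUpto n hp]
    -- `log p κ ≤ log p n + 1`
    rcases Nat.eq_zero_or_pos κ with hκ | hκ
    · subst hκ; simp
    have hn : 0 < n := by omega
    have hlt : κ < p ^ (Nat.log p n + 2) := by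
      have h3 : n < p ^ (Nat.log p n + 1) := Nat.lt_pow_succ_log_self hp.one_lt n
      have h4 : p ^ (Nat.log p n + 1) * 2 ≤ p ^ (Nat.log p n + 2) := by
        rw [pow_succ p (Nat.log p n + 1)]
        exact Nat.mul_le_mul_left _ hp.two_le
      omega
    have hlog : Nat.log p κ < Nat.log p n + 2 := (Nat.log_lt_iff_lt_pow hp.one_lt hκ.ne').2 hlt
    by_cases hle : Nat.log p κ ≤ Nat.log p n
    · omega
    · -- the carry
      have heq : Nat.log p κ = Nat.log p n + 1 := by omega
      have hpow : p ^ (Nat.log p n + 1) ≤ κ := by rw [← heq]; exact Nat.pow_log_le_self p hκ.ne'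
      have hcarry : 1 ≤ (κ.choose n).factorization p := by
        rw [Nat.factorization_choose hp h1 hlog]
        refine Finset.one_le_card.2 ⟨Nat.log p n + 1, ?_⟩
        rw [Finset.mem_filter, Finset.mem_Ico]
        refine ⟨⟨by omega, by omega⟩, ?_⟩
        have hn' : n < p ^ (Nat.log p n + 1) := Nat.lt_pow_succ_log_self hp.one_lt n
        rw [Nat.mod_eq_of_lt hn', Nat.mod_eq_of_lt (by omega)]
        omega
      omega
  · simp [Nat.factorization_eq_zero_of_not_prime _ hp]

/-- Hence `d_κ² ∣ d_n·C(κ,n)·d_{2n}` for `n ≤ κ ≤ 2n` (with the tree's `d_κ ∣ d_{2n}`,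
`Literature.NumberTheory.LFunctions.lcmUpto_dvd_lcmUpto_of_le`). -/
theorem lcmUpto_sq_dvd {n κ : ℕ} (h1 : n ≤ κ) (h2 : κ ≤ 2 * n) :
    Nat.lcmUpto κ ^ 2 ∣ Nat.lcmUpto n * κ.choose n * Nat.lcmUpto (2 * n) := by
  rw [sq]
  exact mul_dvd_mul (lcmUpto_dvd_lcmUpto_mul_choose h1 h2)
    (Literature.NumberTheory.LFunctions.lcmUpto_dvd_lcmUpto_of_le h2)

/-! ### The assembly -/

/-- The weight of (22) on the diagonal at an integer point `κ = k`, `n ≤ k ≤ 2n`, in natural-number binomials: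
`w_κ = (−1)^{3n+k}·C(k,n)·C(n,k−n)²`. -/
theorem w22_aDiag_natCast (n k : ℕ) (h1 : n ≤ k) (h2 : k ≤ 2 * n) :
    w22 (pOf (aDiag n)) (qOf (aDiag n)) (k : ℤ) = (-1) ^ (3 * n + k) * (k.choose n : ℤ) * (n.choose (k - n) : ℤ) ^ 2 := by
  rw [w22_aDiag, show (k : ℤ) - n = ((k - n : ℕ) : ℤ) by omega, zchoose_natCast _ _ h1,
    zchoose_natCast _ _ (by omega), show (3 * (n : ℤ) + k).toNat = 3 * n + k by
      rw [show 3 * (n : ℤ) + k = ((3 * n + k : ℕ) : ℤ) by push_cast; ring, Int.toNat_natCast]]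
  ring

/-- **Brown–Zudilin 2022, display (6), middle inclusion — for every `n ≥ 1`: `2·d_n²·d_{2n}·P̂_n ∈ ℤ`.**
In print an experimental observation (Sect. 2, (6), with the factor `2` that the printed display omits); here a theorem:
Brown–Zudilin's own descent (22) + Rhin–Viola's Theorem 2.1 + Kummer's carry. -/
theorem two_mul_lcm_sq_lcm_two_mul_Phat_isInt (n : ℕ) (hn : 1 ≤ n) :
    ∃ z : ℤ, (z : ℚ) = 2 * (Nat.lcmUpto n : ℚ) ^ 2 * (Nat.lcmUpto (2 * n) : ℚ) * Phat n := by
  obtain ⟨a, ha, hP⟩ := two_mul_Phat_eq_neg_sum n hn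
  -- termwise integrality of `d_n² d_{2n} w_κ a_κ`
  have hterm : ∀ κ ∈ Icc (n : ℤ) (n + n), ∃ z : ℤ,
      (z : ℚ) = (Nat.lcmUpto n : ℚ) ^ 2 * (Nat.lcmUpto (2 * n) : ℚ) * ((w22 (pOf (aDiag n)) (qOf (aDiag n)) κ : ℚ) * a κ) := by
    intro κ hκ
    obtain ⟨A, hA⟩ := ha κ hκ
    rw [mem_Icc] at hκ
    -- `κ = k` a natural number with `n ≤ k ≤ 2n`
    obtain ⟨k, rfl⟩ : ∃ k : ℕ, κ = k := ⟨κ.toNat, (Int.toNat_of_nonneg (by omega)).symm⟩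
    have h1 : n ≤ k := by exact_mod_cast hκ.1
    have h2 : k ≤ 2 * n := by have := hκ.2; omega
    obtain ⟨m, hm⟩ := lcmUpto_sq_dvd h1 h2
    rw [Int.toNat_natCast] at hA
    refine ⟨(-1) ^ (3 * n + k) * (n.choose (k - n) : ℤ) ^ 2 * m * A, ?_⟩
    rw [w22_aDiag_natCast n k h1 h2]
    push_cast
    rw [← hA]
    push_cast
    have hm' : ((Nat.lcmUpto n : ℕ) : ℚ) * (k.choose n : ℚ) * (Nat.lcmUpto (2 * n) : ℚ) =
        (Nat.lcmUpto k : ℚ) ^ 2 * (m : ℚ) := by exact_mod_cast hm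
    linear_combination (-((-1 : ℚ) ^ (3 * n + k) * (n.choose (k - n) : ℚ) ^ 2 * (Nat.lcmUpto n : ℚ) * a k)) * hm'
  choose z hz using hterm
  refine ⟨-∑ κ ∈ (Icc (n : ℤ) (n + n)).attach, z κ.1 κ.2, ?_⟩
  have h2P : 2 * (Nat.lcmUpto n : ℚ) ^ 2 * (Nat.lcmUpto (2 * n) : ℚ) * Phat n =
      (Nat.lcmUpto n : ℚ) ^ 2 * (Nat.lcmUpto (2 * n) : ℚ) * (2 * Phat n) := by ring
  have hS : ∑ κ ∈ Icc (n : ℤ) (n + n),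
      (Nat.lcmUpto n : ℚ) ^ 2 * (Nat.lcmUpto (2 * n) : ℚ) * ((w22 (pOf (aDiag n)) (qOf (aDiag n)) κ : ℚ) * a κ) =
      ∑ κ ∈ (Icc (n : ℤ) (n + n)).attach, (z κ.1 κ.2 : ℚ) := by
    rw [← sum_attach]
    exact sum_congr rfl fun κ _ => (hz κ.1 κ.2).symm
  rw [h2P, hP, mul_neg, mul_sum, hS]
  push_cast
  ring

/-- **Zudilin 2002, display (6), third inclusion — for every `n ≥ 1`: `2·D_n³·p̃_n ∈ ℤ`** (`D_n = lcm(1,…,n)`; in print "shown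
by straightforward calculations on the basis of the recursion", the proved inclusion there being `4D_n⁵p̃_n ∈ ℤ`).  From the
previous theorem through the gauge `p̃_n = (−1)^{n+1}C(2n,n)P̂_n` and `d_{2n} ∣ d_n·C(2n,n)`. -/
theorem two_mul_lcmUpto_pow_three_mul_ptilde_isInt (n : ℕ) (hn : 1 ≤ n) :
    ∃ z : ℤ, (z : ℚ) = 2 * (Nat.lcmUpto n : ℚ) ^ 3 * Zudilin2002.ptilde n := by
  obtain ⟨z, hz⟩ := two_mul_lcm_sq_lcm_two_mul_Phat_isInt n hn
  obtain ⟨m, hm⟩ := lcmUpto_dvd_lcmUpto_mul_choose (le_of_lt (by omega : n < 2 * n)) le_rfl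
  refine ⟨(-1) ^ (n + 1) * m * z, ?_⟩
  rw [ptilde_eq_gauge]
  unfold BrownZudilin2022.gauge
  rw [Nat.centralBinom_eq_two_mul_choose]
  have hm' : ((Nat.lcmUpto n : ℕ) : ℚ) * ((2 * n).choose n : ℚ) = (Nat.lcmUpto (2 * n) : ℚ) * (m : ℚ) := by
    exact_mod_cast hm
  push_cast
  rw [hz]
  linear_combination (2 * (-1 : ℚ) ^ n * (Nat.lcmUpto n : ℚ) ^ 2 * Phat n) * hm'

/-- Display (6) of Brown–Zudilin, middle inclusion, in the shape of `SymmetricFamilyCertificates.denominators` (there for `n ≤ 50`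
by kernel computation; here for all `n ≥ 1`). -/
theorem bz_display6_middle {n : ℕ} (h1 : 1 ≤ n) :
    ∃ z : ℤ, (z : ℚ) = 2 * (Nat.lcmUpto n : ℚ) ^ 2 * (Nat.lcmUpto (2 * n) : ℚ) * Phat n :=
  two_mul_lcm_sq_lcm_two_mul_Phat_isInt n h1

/-- Display (6) of Zudilin 2002, third inclusion, in the shape of `SymmetricFamilyCertificates.zudilin_display6` (there for
`n ≤ 50`; here for all `n ≥ 1`). -/
theorem zudilin_display6_third {n : ℕ} (h1 : 1 ≤ n) :
    ∃ z : ℤ, (z : ℚ) = 2 * (Nat.lcmUpto n : ℚ) ^ 3 * Zudilin2002.ptilde n :=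
  two_mul_lcmUpto_pow_three_mul_ptilde_isInt n h1

end Summit.KontsevichZagierPeriods.Zeta5Search.SymmetricPhatDenominators
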